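import Summits.SmoothPoincare4.SmoothPoincare4.Theorems.CylinderEntropyCylinderRungTwoHamiltonMonotonicityDivergence
import Summits.SmoothPoincare4.SmoothPoincare4.Theorems.CylinderEntropyCylinderRungTwoVerticalTestIdentity
import HarnessLib

/-!
# Route `CylinderEntropy`, crux `CylinderRungTwo` (stmt-SmoothPoincare4-7631), line `killing-flux`:
# the product test identity (registered helper `helper_productTestIdentity`, a first-variation
# identity consumed by the constancy / `S⁴`-equidistribution step of `stub_areaQuantization`)

For a closed immersed cross-section `f : M⁴ → N = S⁴ × ℝ = {z ∈ ℝ⁶ | ∑_{i<5} zᵢ² = 1}` with smooth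
unit normal `ν` tangent to `N` and mean curvature `H` (tree `meanCurvature` of `(f, ν)` in `ℝ⁶`),
for every test function `Φ ∈ C²(ℝ)` of the height `z₅` and every `P ∈ C²(ℝ⁵)` of the horizontal
coordinates `z' = (z₀, …, z₄)` (e.g. a spherical harmonic),

  `∫_M ( [Φ'' P + Φ Δ_{ℝ⁵}P - Φ D²P(z', z') - 4 Φ DP(z')]
        - [Φ'' ν₅² P + 2 Φ' ν₅ DP(ν') + Φ D²P(ν', ν') - |ν'|² Φ DP(z')]
        - H [Φ' ν₅ P + Φ DP(ν')] ) dμ_g = 0`,   `μ_g` the Riemannian measure of `g = f^*δ`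

(`Φ, Φ', Φ''` at `z₅`; `P, DP, D²P` at `z'`; `ν' = (ν₀, …, ν₄)`, `|ν'|² = ∑_{l<5} ν_l²`). This is
Green's identity `∫_M Δ_g(φ ∘ f) dμ_g = 0` for the PRODUCT test function `φ(z) = Φ(z₅) P(z')`: we
apply the landed ambient form of Green's identity (`integral_sliceLaplacian_eq_zero`, part 3 of
Hamilton's monotonicity, `…HamiltonMonotonicityDivergence.lean`) to `φ`, for which, with `T` the
truncation `z ↦ z'` (a continuous linear map) and `a' = T a`,
`Dφ_z(a) = Φ'(z₅) a₅ P(z') + Φ(z₅) DP_{z'}(a')` and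
`D²φ_z(a, b) = Φ''(z₅) a₅ b₅ P(z') + Φ'(z₅) (a₅ DP_{z'}(b') + b₅ DP_{z'}(a')) + Φ(z₅) D²P_{z'}(a', b')`
(second-order Leibniz rule, and the chain rule through `T`), so that
`Δ_{ℝ⁶} φ = Φ'' P + Φ ∑_{j<5} D²P(e'ⱼ, e'ⱼ)` (`T eⱼ = e'ⱼ` for `j < 5`, `T e₅ = 0`),
`D²φ(n, n) = Φ D²P(z', z')` and `Dφ(n) = Φ DP(z')` for the radial normal `n = (z', 0)`,
`D²φ(ν, ν) = Φ'' ν₅² P + 2 Φ' ν₅ DP(ν') + Φ D²P(ν', ν')` and `Dφ(ν) = Φ' ν₅ P + Φ DP(ν')`: the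
integrand of `integral_sliceLaplacian_eq_zero` collapses POINTWISE to the displayed integrand, and no
integrability is needed.

* `fderiv_mul_apply_of_differentiable`, `iteratedFDeriv_two_mul_apply` — first- and second-order
  Leibniz rules for a product of two scalar functions (general normed space);
* `hasFDerivAt_truncComp`, `fderiv_truncComp_apply`, `contDiff_truncComp`,
  `iteratedFDeriv_two_truncComp` — the chain rule through the truncation `T` for `P ∘ T`;
* `contDiff_productTest`, `fderiv_productTest_apply`, `iteratedFDeriv_two_productTest`,
  `sum_iteratedFDeriv_two_productTest_single` — the calculus of `φ = (Φ ∘ e₅^*) · (P ∘ T)` (the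
  factor `Φ ∘ e₅^*` is the vertical test function of `…VerticalTestIdentity.lean`);
* `productTest_identity` — the identity, with implicit binders;
* `helper_productTestIdentity` — the registered helper, verbatim.

With `P = zᵢ` this is the first-moment identity of `…FirstMomentIdentity.lean`, with `P ≡ 1` the
vertical test identity; general `P` (restricted spherical harmonics) is what the
`S⁴`-equidistribution of the area measures per height is tested against.

Everything here is PROVED (no `sorry`, no new definitions, no named facts).

References: R. S. Hamilton, Comm. Anal. Geom. 1 (1993) 127–137, §4 (first variation on slices of
`S⁴ × ℝ`); L. Simon, *Lectures on Geometric Measure Theory* (1983), §16 (first variation,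
`∫ div_M X = -∫ ⟨H⃗, X⟩`).
-/

-- the prescribed namespace `Summit.SmoothPoincare4.SmoothPoincare4.…` repeats `SmoothPoincare4`
set_option linter.dupNamespace false

noncomputable section

open Bundle Set Function Filter MeasureTheory Module
open scoped Manifold ContDiff Topology RealInnerProductSpace BigOperators

namespace Summit.SmoothPoincare4.SmoothPoincare4.Cruxes.CylinderRungTwo.KillingFlux

open Literature.Geometry.Riemannian Literature.Geometry.Riemannian.EuclideanHypersurface
open Literature.Geometry.Lorentzian Literature.Geometry.Lorentzian.PseudoRiemannianMetric
open Literature.Geometry.Riemannian.SphericalCylinderEntropy (truncL truncL_apply)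
open Literature.Geometry.Manifold.CylinderSlice (padL padL_apply_castSucc padL_apply_last
  castSucc_ne_five)

/-! ## Leibniz rules for a product of two scalar functions -/

section Leibniz

variable {E : Type*} [NormedAddCommGroup E] [NormedSpace ℝ E] {u v : E → ℝ}

/-- First-order Leibniz rule `D(u v)_p(a) = Du_p(a) v(p) + u(p) Dv_p(a)` for differentiable scalar
functions. [folklore] -/
theorem fderiv_mul_apply_of_differentiable (hu : Differentiable ℝ u) (hv : Differentiable ℝ v)
    (p a : E) :
    fderiv ℝ (fun z => u z * v z) p a = fderiv ℝ u p a * v p + u p * fderiv ℝ v p a := by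
  rw [fderiv_fun_mul (hu p) (hv p), add_apply, smul_apply, smul_apply, smul_eq_mul, smul_eq_mul]
  ring

/-- Second-order Leibniz rule
`D²(u v)_p(a, b) = D²u_p(a, b) v(p) + Du_p(a) Dv_p(b) + Du_p(b) Dv_p(a) + u(p) D²v_p(a, b)` for
scalar functions of class `C²` (differentiate `D(u v) = u Dv + v Du` once more). [folklore] -/
theorem iteratedFDeriv_two_mul_apply (hu : ContDiff ℝ 2 u) (hv : ContDiff ℝ 2 v) (p a b : E) :
    iteratedFDeriv ℝ 2 (fun z => u z * v z) p ![a, b] =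
      iteratedFDeriv ℝ 2 u p ![a, b] * v p + fderiv ℝ u p a * fderiv ℝ v p b
        + fderiv ℝ u p b * fderiv ℝ v p a + u p * iteratedFDeriv ℝ 2 v p ![a, b] := by
  have hu1 : Differentiable ℝ u := hu.differentiable two_ne_zero
  have hv1 : Differentiable ℝ v := hv.differentiable two_ne_zero
  have hu2 : Differentiable ℝ (fderiv ℝ u) :=
    (hu.fderiv_right (m := 1) (by norm_num)).differentiable one_ne_zero
  have hv2 : Differentiable ℝ (fderiv ℝ v) :=
    (hv.fderiv_right (m := 1) (by norm_num)).differentiable one_ne_zero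
  have h1 : fderiv ℝ (fun z => u z * v z) = fun q => u q • fderiv ℝ v q + v q • fderiv ℝ u q :=
    funext fun q => fderiv_fun_mul (hu1 q) (hv1 q)
  have h2 : HasFDerivAt (fderiv ℝ (fun z => u z * v z))
      ((u p • fderiv ℝ (fderiv ℝ v) p + (fderiv ℝ u p).smulRight (fderiv ℝ v p))
        + (v p • fderiv ℝ (fderiv ℝ u) p + (fderiv ℝ v p).smulRight (fderiv ℝ u p))) p := by
    rw [h1]
    exact ((hu1 p).hasFDerivAt.fun_smul (hv2 p).hasFDerivAt).add
      ((hv1 p).hasFDerivAt.fun_smul (hu2 p).hasFDerivAt)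
  simp only [iteratedFDeriv_two_apply, Matrix.cons_val_zero, Matrix.cons_val_one]
  rw [h2.fderiv]
  simp only [add_apply, smul_apply, ContinuousLinearMap.smulRight_apply, smul_eq_mul]
  ring

end Leibniz

/-! ## The chain rule through the truncation `T : ℝ⁶ → ℝ⁵`, `z ↦ z'` -/

section TruncComp

variable {P : EuclideanSpace ℝ (Fin 5) → ℝ}

/-- `z ↦ P(z')` has derivative `DP_{p'} ∘ T` at `p` for `P` differentiable (`T = truncL` is a
continuous linear map). [folklore] -/
theorem hasFDerivAt_truncComp (hP : Differentiable ℝ P) (p : EuclideanSpace ℝ (Fin 6)) :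
    HasFDerivAt (fun z : EuclideanSpace ℝ (Fin 6) => P (truncL z))
      ((fderiv ℝ P (truncL p)).comp truncL) p :=
  (hP (truncL p)).hasFDerivAt.comp p truncL.hasFDerivAt

/-- `D(P ∘ T)_p(a) = DP_{p'}(a')`. [folklore] -/
theorem fderiv_truncComp_apply (hP : Differentiable ℝ P) (p a : EuclideanSpace ℝ (Fin 6)) :
    fderiv ℝ (fun z : EuclideanSpace ℝ (Fin 6) => P (truncL z)) p a =
      fderiv ℝ P (truncL p) (truncL a) := by
  rw [(hasFDerivAt_truncComp hP p).fderiv, ContinuousLinearMap.coe_comp, Function.comp_apply]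

/-- `P ∘ T` is `C²` for `P ∈ C²`. [folklore] -/
theorem contDiff_truncComp (hP : ContDiff ℝ 2 P) :
    ContDiff ℝ 2 (fun z : EuclideanSpace ℝ (Fin 6) => P (truncL z)) :=
  hP.comp truncL.contDiff

/-- `D²(P ∘ T)_p(a, b) = D²P_{p'}(a', b')` for `P ∈ C²`
(`ContinuousLinearMap.iteratedFDeriv_comp_right`). [folklore] -/
theorem iteratedFDeriv_two_truncComp (hP : ContDiff ℝ 2 P) (p a b : EuclideanSpace ℝ (Fin 6)) :
    iteratedFDeriv ℝ 2 (fun z : EuclideanSpace ℝ (Fin 6) => P (truncL z)) p ![a, b] =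
      iteratedFDeriv ℝ 2 P (truncL p) ![truncL a, truncL b] := by
  rw [show (fun z : EuclideanSpace ℝ (Fin 6) => P (truncL z)) = P ∘ ⇑truncL from rfl,
    truncL.iteratedFDeriv_comp_right hP p (i := 2) (mod_cast le_rfl),
    ContinuousMultilinearMap.compContinuousLinearMap_apply]
  simp only [iteratedFDeriv_two_apply, Matrix.cons_val_zero, Matrix.cons_val_one]

end TruncComp

/-! ## Calculus of the product test function `φ(z) = Φ(z₅) P(z')` on `ℝ⁶` -/

section ProductTest

variable {Φ : ℝ → ℝ} {P : EuclideanSpace ℝ (Fin 5) → ℝ}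

/-- `φ(z) = Φ(z₅) P(z')` is `C²` for `Φ, P ∈ C²`. [folklore] -/
theorem contDiff_productTest (hΦ : ContDiff ℝ 2 Φ) (hP : ContDiff ℝ 2 P) :
    ContDiff ℝ 2 (fun z : EuclideanSpace ℝ (Fin 6) => Φ (z 5) * P (truncL z)) :=
  (contDiff_verticalTest hΦ).mul (contDiff_truncComp hP)

/-- `Dφ_p(a) = Φ'(p₅) a₅ P(p') + Φ(p₅) DP_{p'}(a')` for `Φ, P` differentiable. [folklore] -/
theorem fderiv_productTest_apply (hΦ : Differentiable ℝ Φ) (hP : Differentiable ℝ P)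
    (p a : EuclideanSpace ℝ (Fin 6)) :
    fderiv ℝ (fun z : EuclideanSpace ℝ (Fin 6) => Φ (z 5) * P (truncL z)) p a =
      deriv Φ (p 5) * a 5 * P (truncL p) + Φ (p 5) * fderiv ℝ P (truncL p) (truncL a) := by
  rw [fderiv_mul_apply_of_differentiable (u := fun z : EuclideanSpace ℝ (Fin 6) => Φ (z 5))
      (v := fun z : EuclideanSpace ℝ (Fin 6) => P (truncL z))
      (fun q => (hasFDerivAt_verticalTest hΦ q).differentiableAt) (hP.comp truncL.differentiable)
      p a,
    fderiv_verticalTest_apply hΦ, fderiv_truncComp_apply hP]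

/-- `D²φ_p(a, b) = Φ''(p₅) a₅ b₅ P(p') + Φ'(p₅) a₅ DP_{p'}(b') + Φ'(p₅) b₅ DP_{p'}(a')
  + Φ(p₅) D²P_{p'}(a', b')` for `Φ, P ∈ C²` (for `Φ ∈ C²`, `deriv (deriv Φ)` is the genuine second
derivative). [folklore] -/
theorem iteratedFDeriv_two_productTest (hΦ : ContDiff ℝ 2 Φ) (hP : ContDiff ℝ 2 P)
    (p a b : EuclideanSpace ℝ (Fin 6)) :
    iteratedFDeriv ℝ 2 (fun z : EuclideanSpace ℝ (Fin 6) => Φ (z 5) * P (truncL z)) p ![a, b] =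
      deriv (deriv Φ) (p 5) * a 5 * b 5 * P (truncL p)
        + deriv Φ (p 5) * a 5 * fderiv ℝ P (truncL p) (truncL b)
        + deriv Φ (p 5) * b 5 * fderiv ℝ P (truncL p) (truncL a)
        + Φ (p 5) * iteratedFDeriv ℝ 2 P (truncL p) ![truncL a, truncL b] := by
  have hd : Differentiable ℝ Φ := hΦ.differentiable two_ne_zero
  have hPd : Differentiable ℝ P := hP.differentiable two_ne_zero
  rw [iteratedFDeriv_two_mul_apply (u := fun z : EuclideanSpace ℝ (Fin 6) => Φ (z 5))
      (v := fun z : EuclideanSpace ℝ (Fin 6) => P (truncL z)) (contDiff_verticalTest hΦ)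
      (contDiff_truncComp hP) p a b,
    iteratedFDeriv_two_verticalTest hΦ, iteratedFDeriv_two_truncComp hP,
    fderiv_verticalTest_apply hd, fderiv_verticalTest_apply hd, fderiv_truncComp_apply hPd,
    fderiv_truncComp_apply hPd]

/-- `Δ_{ℝ⁶} φ = ∑ⱼ D²φ(eⱼ, eⱼ) = Φ''(z₅) P(z') + Φ(z₅) ∑_{j<5} D²P_{z'}(e'ⱼ, e'ⱼ)` (`T eⱼ = e'ⱼ` and
`(eⱼ)₅ = 0` for `j < 5`; `T e₅ = 0` and `(e₅)₅ = 1`). [folklore] -/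
theorem sum_iteratedFDeriv_two_productTest_single (hΦ : ContDiff ℝ 2 Φ) (hP : ContDiff ℝ 2 P)
    (p : EuclideanSpace ℝ (Fin 6)) :
    ∑ j : Fin 6, iteratedFDeriv ℝ 2
        (fun z : EuclideanSpace ℝ (Fin 6) => Φ (z 5) * P (truncL z)) p
        ![EuclideanSpace.single j (1 : ℝ), EuclideanSpace.single j (1 : ℝ)] =
      deriv (deriv Φ) (p 5) * P (truncL p)
        + Φ (p 5) * ∑ j : Fin 5, iteratedFDeriv ℝ 2 P (truncL p)
            ![EuclideanSpace.single j (1 : ℝ), EuclideanSpace.single j (1 : ℝ)] := by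
  -- `(eⱼ)₅ = 0` for `j < 5`
  have h5 : ∀ i : Fin 5, ((5 : Fin 6) = Fin.castSucc i) ↔ False :=
    fun i => iff_false_intro (castSucc_ne_five i).symm
  rw [Fin.sum_univ_castSucc]
  -- split off `j = 5` (where `T e₅ = 0`) from `j < 5` (where `T eⱼ = e'ⱼ`)
  simp only [iteratedFDeriv_two_productTest hΦ hP, truncL_single_castSucc, truncL_single_last,
    PiLp.single_apply, h5, if_false, map_zero]
  simp only [show (Fin.last 5 : Fin 6) = 5 from rfl, if_true, iteratedFDeriv_two_apply,
    Matrix.cons_val_zero, Matrix.cons_val_one, map_zero, Finset.mul_sum]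
  ring

end ProductTest

/-! ## The product test identity -/

section Identity

variable {M : Type*} [TopologicalSpace M] [ChartedSpace (EuclideanSpace ℝ (Fin 4)) M]
  [IsManifold (𝓡 4) ∞ M] [CompactSpace M] [T2Space M] [MeasurableSpace M] [BorelSpace M]

/-- **The product test identity** for a closed immersed cross-section `f : M⁴ → N = S⁴ × ℝ ⊂ ℝ⁶`
with smooth unit normal `ν` tangent to `N`, mean curvature `H` of `(f, ν)`, `g = f^*δ`, any
`Φ ∈ C²(ℝ)` and any `P ∈ C²(ℝ⁵)`:
`∫_M ([Φ''P + ΦΔ_{ℝ⁵}P - ΦD²P(z',z') - 4ΦDP(z')] - [Φ''ν₅²P + 2Φ'ν₅DP(ν') + ΦD²P(ν',ν') - |ν'|²ΦDP(z')]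
  - H[Φ'ν₅P + ΦDP(ν')]) dμ_g = 0`
(`Φ, Φ', Φ''` at `z₅`, `P, DP, D²P` at `z'`): Green's identity `∫_M Δ_g(φ ∘ f) dμ_g = 0` in ambient
terms (`integral_sliceLaplacian_eq_zero`) for `φ(z) = Φ(z₅) P(z')`, whose integrand is the displayed
one pointwise (`Dφ_p(a) = Φ'a₅P + ΦDP(a')`,
`D²φ_p(a,b) = Φ''a₅b₅P + Φ'(a₅DP(b') + b₅DP(a')) + ΦD²P(a',b')`, `n₅ = 0`, `n' = z'`).
Equivalently: the first variation of area along `∇(Φ(z₅) P(z'))`. [cite: Hamilton1993, §4] -/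
theorem productTest_identity {f νf : M → EuclideanSpace ℝ (Fin 6)}
    (hf : (euclideanMetric (EuclideanSpace ℝ (Fin 6))).IsSpacelikeImmersion (𝓡 4) f)
    (hν : ContMDiff (𝓡 4) 𝓘(ℝ, EuclideanSpace ℝ (Fin 6)) ∞ νf)
    (hun : (euclideanMetric (EuclideanSpace ℝ (Fin 6))).IsUnitNormal (𝓡 4) f νf 1)
    (hN : ∀ x, ∑ i : Fin 5, f x (Fin.castSucc i) ^ 2 = 1)
    (hνN : ∀ x, ∑ i : Fin 5, νf x (Fin.castSucc i) * f x (Fin.castSucc i) = 0)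
    {Φ : ℝ → ℝ} (hΦ : ContDiff ℝ 2 Φ) {P : EuclideanSpace ℝ (Fin 5) → ℝ} (hP : ContDiff ℝ 2 P) :
    ∫ w, ((deriv (deriv Φ) (f w 5) * P (truncL (f w))
            + Φ (f w 5) * (∑ j : Fin 5, iteratedFDeriv ℝ 2 P (truncL (f w))
                ![EuclideanSpace.single j (1 : ℝ), EuclideanSpace.single j (1 : ℝ)])
            - Φ (f w 5) * iteratedFDeriv ℝ 2 P (truncL (f w)) ![truncL (f w), truncL (f w)]
            - 4 * (Φ (f w 5) * fderiv ℝ P (truncL (f w)) (truncL (f w))))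
        - (deriv (deriv Φ) (f w 5) * νf w 5 ^ 2 * P (truncL (f w))
            + 2 * (deriv Φ (f w 5) * νf w 5 * fderiv ℝ P (truncL (f w)) (truncL (νf w)))
            + Φ (f w 5) * iteratedFDeriv ℝ 2 P (truncL (f w)) ![truncL (νf w), truncL (νf w)]
            - (∑ l : Fin 5, νf w (Fin.castSucc l) ^ 2)
                * (Φ (f w 5) * fderiv ℝ P (truncL (f w)) (truncL (f w))))
        - (euclideanMetric (EuclideanSpace ℝ (Fin 6))).meanCurvature f contMDiff_pullbackBilin_holds
            hf νf w * (deriv Φ (f w 5) * νf w 5 * P (truncL (f w))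
              + Φ (f w 5) * fderiv ℝ P (truncL (f w)) (truncL (νf w))))
      ∂riemannianMeasure ((euclideanMetric (EuclideanSpace ℝ (Fin 6))).inducedRiemannianMetric f
        contMDiff_pullbackBilin_holds hf) = 0 := by
  -- Green's identity for `φ = (Φ ∘ e₅^*) · (P ∘ T)`
  have h0 := integral_sliceLaplacian_eq_zero hf hν hun hN hνN (contDiff_productTest hΦ hP)
  have hd : Differentiable ℝ Φ := hΦ.differentiable two_ne_zero
  have hPd : Differentiable ℝ P := hP.differentiable two_ne_zero
  -- the integrand, pointwise (`H`, `S` stand for the mean curvature and `|ν'|²`)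
  have hpt : ∀ (w) (H S : ℝ),
      (((∑ j : Fin 6, iteratedFDeriv ℝ 2
              (fun z : EuclideanSpace ℝ (Fin 6) => Φ (z 5) * P (truncL z)) (f w)
              ![EuclideanSpace.single j (1 : ℝ), EuclideanSpace.single j (1 : ℝ)])
            - iteratedFDeriv ℝ 2 (fun z : EuclideanSpace ℝ (Fin 6) => Φ (z 5) * P (truncL z))
                (f w) ![padL (truncL (f w)), padL (truncL (f w))]
            - 4 * fderiv ℝ (fun z : EuclideanSpace ℝ (Fin 6) => Φ (z 5) * P (truncL z)) (f w)
                (padL (truncL (f w))))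
          - (iteratedFDeriv ℝ 2 (fun z : EuclideanSpace ℝ (Fin 6) => Φ (z 5) * P (truncL z))
                (f w) ![νf w, νf w]
            - S * fderiv ℝ (fun z : EuclideanSpace ℝ (Fin 6) => Φ (z 5) * P (truncL z)) (f w)
                (padL (truncL (f w))))
          - H * fderiv ℝ (fun z : EuclideanSpace ℝ (Fin 6) => Φ (z 5) * P (truncL z)) (f w)
              (νf w))
        = ((deriv (deriv Φ) (f w 5) * P (truncL (f w))
              + Φ (f w 5) * (∑ j : Fin 5, iteratedFDeriv ℝ 2 P (truncL (f w))
                  ![EuclideanSpace.single j (1 : ℝ), EuclideanSpace.single j (1 : ℝ)])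
              - Φ (f w 5) * iteratedFDeriv ℝ 2 P (truncL (f w)) ![truncL (f w), truncL (f w)]
              - 4 * (Φ (f w 5) * fderiv ℝ P (truncL (f w)) (truncL (f w))))
          - (deriv (deriv Φ) (f w 5) * νf w 5 ^ 2 * P (truncL (f w))
              + 2 * (deriv Φ (f w 5) * νf w 5 * fderiv ℝ P (truncL (f w)) (truncL (νf w)))
              + Φ (f w 5) * iteratedFDeriv ℝ 2 P (truncL (f w)) ![truncL (νf w), truncL (νf w)]
              - S * (Φ (f w 5) * fderiv ℝ P (truncL (f w)) (truncL (f w))))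
          - H * (deriv Φ (f w 5) * νf w 5 * P (truncL (f w))
              + Φ (f w 5) * fderiv ℝ P (truncL (f w)) (truncL (νf w)))) := by
    intro w H S
    rw [sum_iteratedFDeriv_two_productTest_single hΦ hP, iteratedFDeriv_two_productTest hΦ hP,
      iteratedFDeriv_two_productTest hΦ hP, fderiv_productTest_apply hd hPd,
      fderiv_productTest_apply hd hPd, padL_apply_last, truncL_padL]
    ring
  exact (integral_congr_ae (Eventually.of_forall fun w => (hpt w _ _).symm)).trans h0

end Identity

/-- **Registered helper `helper_productTestIdentity` of line `killing-flux` (a first-variation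
identity on closed cross-sections, consumed by the constancy / `S⁴`-equidistribution step of the
area-quantization argument).** For a closed immersed cross-section `f : M⁴ → N = S⁴ × ℝ` with smooth
unit normal `ν` tangent to `N`, mean curvature `H` of `(f, ν)`, any `Φ ∈ C²(ℝ)` and `P ∈ C²(ℝ⁵)`:
`∫_M ([Φ''P + ΦΔ_{ℝ⁵}P - ΦD²P(z',z') - 4ΦDP(z')] - [Φ''ν₅²P + 2Φ'ν₅DP(ν') + ΦD²P(ν',ν') - |ν'|²ΦDP(z')]
  - H[Φ'ν₅P + ΦDP(ν')]) dμ_g = 0`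
(`Φ, Φ', Φ''` at `z₅`, `P, DP, D²P` at `z' = truncL z`; `μ_g` the Riemannian measure of `g = f^*δ`;
`productTest_identity`). [cite: Hamilton1993, §4] -/
theorem helper_productTestIdentity :
    ∀ (M : Type) [TopologicalSpace M] [ChartedSpace (EuclideanSpace ℝ (Fin 4)) M] [IsManifold (𝓡 4) ∞ M] [CompactSpace M] [T2Space M] [MeasurableSpace M] [BorelSpace M] (f νf : M → EuclideanSpace ℝ (Fin 6)) (hf : (Literature.Geometry.Riemannian.euclideanMetric (EuclideanSpace ℝ (Fin 6))).IsSpacelikeImmersion (𝓡 4) f), ContMDiff (𝓡 4) (𝓡 6) ∞ νf → (Literature.Geometry.Riemannian.euclideanMetric (EuclideanSpace ℝ (Fin 6))).IsUnitNormal (𝓡 4) f νf 1 → (∀ x, ∑ i : Fin 5, f x (Fin.castSucc i) ^ 2 = 1) → (∀ x, ∑ i : Fin 5, νf x (Fin.castSucc i) * f x (Fin.castSucc i) = 0) → ∀ (Φ : ℝ → ℝ), ContDiff ℝ 2 Φ → ∀ (P : EuclideanSpace ℝ (Fin 5) → ℝ), ContDiff ℝ 2 P → ∫ w, ((deriv (deriv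 Φ) (f w 5) * P (Literature.Geometry.Riemannian.SphericalCylinderEntropy.truncL (f w)) + Φ (f w 5) * (∑ j : Fin 5, iteratedFDeriv ℝ 2 P (Literature.Geometry.Riemannian.SphericalCylinderEntropy.truncL (f w)) ![EuclideanSpace.single j (1 : ℝ), EuclideanSpace.single j (1 : ℝ)]) - Φ (f w 5) * iteratedFDeriv ℝ 2 P (Literature.Geometry.Riemannian.SphericalCylinderEntropy.truncL (f w)) ![Literature.Geometry.Riemannian.SphericalCylinderEntropy.truncL (f w), Literature.Geometry.Riemannian.SphericalCylinderEntropy.truncL (f w)] - 4 * (Φ (f w 5) * fderiv ℝ P (Literature.Geometry.Riemannian.SphericalCylinderEntropy.truncL (f w)) (Literature.Geometry.Riemannian.SphericalCylinderEntropy.truncL (f w)))) - (deriv (deriv Φ) (f w 5) * νf w 5 ^ 2 * P (Literature.Geometry.Riemannian.SphericalCylinderEntropy.truncL (f w)) + 2 * (deriv Φ (f w 5) * νf w 5 * fderiv ℝ P (Literature.Geometry.Riemannian.SphericalCylinderEntropy.truncL (f w)) (Literature.Geometry.Riemannian.SphericalCylinderEntropy.truncL (νf w))) + Φ (f w 5)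 * iteratedFDeriv ℝ 2 P (Literature.Geometry.Riemannian.SphericalCylinderEntropy.truncL (f w)) ![Literature.Geometry.Riemannian.SphericalCylinderEntropy.truncL (νf w), Literature.Geometry.Riemannian.SphericalCylinderEntropy.truncL (νf w)] - (∑ l : Fin 5, νf w (Fin.castSucc l) ^ 2) * (Φ (f w 5) * fderiv ℝ P (Literature.Geometry.Riemannian.SphericalCylinderEntropy.truncL (f w)) (Literature.Geometry.Riemannian.SphericalCylinderEntropy.truncL (f w)))) - (Literature.Geometry.Riemannian.euclideanMetric (EuclideanSpace ℝ (Fin 6))).meanCurvature f Literature.Geometry.Lorentzian.PseudoRiemannianMetric.contMDiff_pullbackBilin_holds hf νf w * (deriv Φ (f w 5) * νf w 5 * P (Literature.Geometry.Riemannian.SphericalCylinderEntropy.truncL (f w)) + Φ (f w 5) * fderiv ℝ P (Literature.Geometry.Riemannian.SphericalCylinderEntropy.truncL (f w)) (Literature.Geometry.Riemannian.SphericalCylinderEntropy.truncL (νf w)))) ∂Literature.Geometry.Lorentzian.riemannianMeasure ((Literature.Geometry.Riemannian.euclideanMetric (EuclideanSpace ℝ (Fin 6))).inducedRiemannianMetric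 f Literature.Geometry.Lorentzian.PseudoRiemannianMetric.contMDiff_pullbackBilin_holds hf) = 0 :=
  fun _ _ _ _ _ _ _ _ _ _ hf hν hun hN hνN _ hΦ _ hP =>
    productTest_identity hf hν hun hN hνN hΦ hP

end Summit.SmoothPoincare4.SmoothPoincare4.Cruxes.CylinderRungTwo.KillingFlux

end
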